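import Mathlib
import Literature.MathematicalPhysics.QuantumFieldTheory.MassGapFromLatticeClustering
import Summits.QuantumFields.YangMills.Theorems.ConvexGribovBodyContinuumLegGivenGapStubUclOfCsclTilt
import HarnessLib

/-!
# `ContinuumLegGivenGap` (stmt-QuantumFields-15828), line `Sketch`, reshape 18c: `stub_csclSupport` — finite sums of slab-ordered real product tensors live in one positive ordered time slab

Support file for the crux item stmt-QuantumFields-15828 (registered glue stub `stub_csclSupport` of line `Sketch`,
reshape 18c). An elementary support computation used by the Cauchy–Schwarz clustering step: if
`gᵢ = ⊗ₗ pᵢₗ` (`IsTensorOf (g i) fun l => ofRealTest (p i l)`) with slab-ordered real factor data `pᵢ`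
(`IsSlabOrdered (p i)`: time slabs `0 < loₗ ≤ hiₗ < lo_{l'}` for `l < l'` containing the supports of the factors),
then the finite sum `∑ᵢ cᵢ • gᵢ` is supported in the positive ordered slab
`{x | δ ≤ xₗ⁰ ≤ T₀ ∧ xₗ⁰ + δ ≤ x_{l'}⁰ (l < l')}` for some margin `δ > 0` and height `T₀`.

Proof: the support of the sum lies in the union of the supports of the `gᵢ` (closure of a finite union);
on `tsupport gᵢ` every point time `xₗ⁰` lies in the slab `[loᵢₗ, hiᵢₗ]` (`IsTensorOf.tsupport_subset` and
`tsupport (ofRealTest f) ⊆ tsupport f`); `δ` is a positive lower bound of the finitely many positive margins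
`loᵢₗ`, `loᵢₗ' − hiᵢₗ` (`l < l'`), and `T₀` an upper bound of the finitely many `hiᵢₗ`.

No definitions, no facts; Mathlib + the tree definitions `IsTensorOf`, `IsSlabOrdered`, `ofRealTest`, the tree
lemma `IsTensorOf.tsupport_subset` and the landed elementary lemma `exists_pos_le_forall` (file
`ConvexGribovBodyContinuumLegGivenGapStubUclOfCsclTilt`) only. [folklore]
-/

noncomputable section

namespace Summit.QuantumFields.YangMills.Theorems.ContinuumLegGivenGap

open scoped SchwartzMap ComplexConjugate
open Filter Topology MeasureTheory
open Literature.MathematicalPhysics.QuantumFieldTheory Literature.MathematicalPhysics.QuantumLattice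
  Literature.MathematicalPhysics.AQFT Literature.Probability.LatticeModels

/-- **Upper bound of a finite family of reals**: some `T` satisfies `f i ≤ T` for all `i` in a finite index
type. [folklore] -/
theorem csclSupport_exists_ge {ι : Type*} [Finite ι] (f : ι → ℝ) : ∃ T : ℝ, ∀ i, f i ≤ T := by
  have h : ∀ᶠ T in atTop, ∀ i, f i ≤ T := Filter.eventually_all.2 fun i => eventually_ge_atTop (f i)
  exact h.exists

/-- **The support of a finite linear combination of Schwartz functions** lies in the union of the supports
of its terms. [folklore] -/
theorem csclSupport_tsupport_sum_subset {X : Type*} [NormedAddCommGroup X] [NormedSpace ℝ X] {N : ℕ}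
    (c : Fin N → ℂ) (g : Fin N → 𝓢(X, ℂ)) :
    tsupport ((∑ i, c i • g i : 𝓢(X, ℂ)) : X → ℂ) ⊆ ⋃ i, tsupport (g i : X → ℂ) := by
  have h1 : Function.support ((∑ i, c i • g i : 𝓢(X, ℂ)) : X → ℂ) ⊆
      ⋃ i, Function.support (g i : X → ℂ) := by
    intro y hy
    rw [Function.mem_support, sum_apply] at hy
    obtain ⟨i, -, hi⟩ := Finset.exists_ne_zero_of_sum_ne_zero hy
    rw [smul_apply] at hi
    exact Set.mem_iUnion.2 ⟨i, right_ne_zero_of_smul hi⟩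
  intro x hx
  have h2 := closure_mono h1 hx
  rwa [closure_iUnion_of_finite] at h2

/-- `stub_csclSupport` — **finite sums of slab-ordered real product tensors live in one positive ordered time
slab** (reshape 18c glue, elementary): if `gᵢ = ⊗ₗ pᵢₗ` with slab-ordered real factor data `pᵢ` (`IsSlabOrdered`:
slabs `0 < loₗ ≤ hiₗ < lo_{l'}` for `l < l'`), then `∑ᵢ cᵢ gᵢ` is supported in
`{x | δ ≤ xₗ⁰ ≤ T₀, xₗ⁰ + δ ≤ x_{l'}⁰ (l < l')}` for some `δ > 0`, `T₀` (`IsTensorOf.tsupport_subset`, the support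
of a finite sum, a positive lower bound of the finitely many positive margins). [folklore] -/
theorem stub_csclSupport :
    ∀ (n N : ℕ) (c : Fin N → ℂ) (g : Fin N → SchwartzMap (Fin n → EuclideanSpace ℝ (Fin 4)) ℂ)
      (p : Fin N → Fin n → SchwartzMap (EuclideanSpace ℝ (Fin 4)) ℝ),
      (∀ i, IsTensorOf (g i) fun l => ofRealTest (p i l)) → (∀ i, IsSlabOrdered (p i)) →
      ∃ δ T₀ : ℝ, 0 < δ ∧
        tsupport ((∑ i, c i • g i : SchwartzMap (Fin n → EuclideanSpace ℝ (Fin 4)) ℂ) :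
            (Fin n → EuclideanSpace ℝ (Fin 4)) → ℂ) ⊆
          {x | (∀ l, δ ≤ x l 0 ∧ x l 0 ≤ T₀) ∧ ∀ l l', l < l' → x l 0 + δ ≤ x l' 0} := by
  intro n N c g p hg hp
  choose lo hi hlo _hle hord hsupp using hp
  -- pointwise slab bounds on the support of each `g i`
  have hgi : ∀ i x, x ∈ tsupport (g i : (Fin n → EuclideanSpace ℝ (Fin 4)) → ℂ) →
      ∀ l, lo i l ≤ x l 0 ∧ x l 0 ≤ hi i l := fun i x hx l =>
    hsupp i l (tsupport_comp_subset (g := fun t : ℝ => (t : ℂ)) Complex.ofReal_zero _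
      ((hg i).tsupport_subset hx l))
  -- the margins: finite families of positive reals
  obtain ⟨δ₁, hδ₁, hδ₁le⟩ := exists_pos_le_forall (fun il : Fin N × Fin n => lo il.1 il.2)
    fun il => hlo il.1 il.2
  obtain ⟨δ₂, hδ₂, hδ₂le⟩ := exists_pos_le_forall
    (fun ill : {ill : Fin N × Fin n × Fin n // ill.2.1 < ill.2.2} =>
      lo ill.1.1 ill.1.2.2 - hi ill.1.1 ill.1.2.1)
    fun ill => sub_pos.2 (hord ill.1.1 _ _ ill.2)
  obtain ⟨T₀, hT₀⟩ := csclSupport_exists_ge fun il : Fin N × Fin n => hi il.1 il.2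
  refine ⟨min δ₁ δ₂, T₀, lt_min hδ₁ hδ₂, fun x hx => ?_⟩
  obtain ⟨i, hxi⟩ := Set.mem_iUnion.1 (csclSupport_tsupport_sum_subset c g hx)
  have hb := hgi i x hxi
  refine ⟨fun l => ⟨(min_le_left _ _).trans ((hδ₁le (i, l)).trans (hb l).1),
    (hb l).2.trans (hT₀ (i, l))⟩, fun l l' hll' => ?_⟩
  have h2 : δ₂ ≤ lo i l' - hi i l := hδ₂le ⟨(i, l, l'), hll'⟩
  have h3 := (hb l).2
  have h4 := (hb l').1
  have h5 := min_le_right δ₁ δ₂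
  linarith

end Summit.QuantumFields.YangMills.Theorems.ContinuumLegGivenGap

end
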